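import Literature.NumberTheory.EllipticCurves.ModPImageDivisionPolynomialCriterionProofs
import HarnessLib

/-!
# Non-surjectivity of `ρ̄_{E,p}` (`p` odd) from a factor of `ψ_p` defined over a QUADRATIC field

THEOREMS ONLY (no definition, no named fact). Companion of the cubic-field criterion at `5`
(`ModFiveImageCubicFieldCriterionProofs.lean`): let `E = W/ℚ` be elliptic, `p` an ODD prime, `u ∈
    ℚ̄` a
root of a non-zero `c ∈ ℚ[X]` of degree `≤ 2`, and `g ∈ ℚ⟮u⟯[X]` with `0 < deg g ≤ p` a factor of
    the
`p`-division polynomial `ψ_p` of `W` over `ℚ⟮u⟯`. Then `ρ̄_{E,p} : Γ_ℚ → Aut(E[p])` is NOT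
    surjective.

Proof (`not_hasSurjectiveModNGaloisRep_of_dvd_preΨ_quadratic`). As at `5`: the set
`S = {P ∈ E[p] ∖ O : g(x(P)) = 0}` is non-empty, misses some non-zero point, and is stable under the
stabiliser `Γ₁` of `u`; `τ² ∈ Γ₁` for every `τ ∈ Γ_ℚ` (pigeonhole on `u, τu, τ²u` among the `≤ 2`
    roots
of `c`). If `ρ̄` were onto, every UNIPOTENT `γ ∈ Aut(E[p])` (`p • γ = 0` in the additive group
`AddAut`) would lie in `ρ̄(Γ₁)`: `γ = 2 • ((p+1)/2 • γ)` and `(p+1)/2 • γ = ρ̄(τ)` gives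
`γ = ρ̄(τ²)`; but unipotents act transitively on `𝔽_p² ∖ 0` — contradiction. Used for Zywina's
`N_s(7)` `j`-line through the degree-`2` cover `X_s(7) → X_0(7)` (a curve with
    split-Cartan-normaliser
image acquires a `7`-isogeny over a quadratic field).

References: J.-P. Serre, Invent. Math. 15 (1972) §2; D. Zywina, arXiv:1508.07660 (2015), §1.4;
J. H. Silverman, *AEC* (2009), III.§7, Exercise 3.7.
-/

noncomputable section

open scoped Classical IntermediateField
open Polynomial Field

namespace WeierstrassCurve

open Literature.NumberTheory.EllipticCurves

/-! ### Unipotent automorphisms of a plane over `𝔽_p` move any non-zero vector to any other -/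

/-- A unipotent shear: for `v`, `w − v` linearly independent in a plane `V` over `𝔽_p` there is an
additive automorphism `γ` of `V` with `γ v = w` and `p • γ = 0` (i.e. `γᵖ = 1`: `γ = 1 + N`, `N² =
    0`).
[folklore] -/
private theorem exists_unipotent_apply_eq (p : ℕ) [Fact p.Prime] {V : Type*} [AddCommGroup V]
    [Module (ZMod p) V] (h2 : Module.finrank (ZMod p) V = 2) {v w : V}
    (hvw : LinearIndependent (ZMod p) ![v, w - v]) :
    ∃ γ : AddAut V, γ v = w ∧ p • γ = 0 := by
  haveI : FiniteDimensional (ZMod p) V := .of_finrank_pos (by omega)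
  have hcard : Fintype.card (Fin 2) = Module.finrank (ZMod p) V := by rw [Fintype.card_fin, h2]
  let b := basisOfLinearIndependentOfCardEqFinrank hvw hcard
  have hb0 : b 0 = v := by simp [b]
  have hb1 : b 1 = w - v := by simp [b]
  -- the shear `T`: `T v = w`, `T (w - v) = w - v`
  let T : V →ₗ[ZMod p] V := b.constr (ZMod p) ![w, w - v]
  have hT0 : T (b 0) = b 0 + b 1 := by
    rw [show T (b 0) = ![w, w - v] 0 from b.constr_basis (ZMod p) _ 0, hb0, hb1]
    simp
  have hT1 : T (b 1) = b 1 := by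
    rw [show T (b 1) = ![w, w - v] 1 from b.constr_basis (ZMod p) _ 1, hb1]
    simp
  have hTn1 : ∀ n : ℕ, (T ^ n) (b 1) = b 1 := by
    intro n
    induction n with
    | zero => simp
    | succ n ih => rw [pow_succ, Module.End.mul_apply, hT1, ih]
  have hTn0 : ∀ n : ℕ, (T ^ n) (b 0) = b 0 + (n : ZMod p) • b 1 := by
    intro n
    induction n with
    | zero => simp
    | succ n ih =>
      rw [pow_succ, Module.End.mul_apply, hT0, map_add, ih, hTn1]
      push_cast
      rw [add_smul, one_smul, add_assoc]
  have hp1 : 1 ≤ p := (Fact.out : p.Prime).one_lt.le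
  have hTp : T ^ p = 1 := by
    refine b.ext fun i ↦ ?_
    rw [Module.End.one_apply]
    fin_cases i
    · simp only [Fin.zero_eta, Fin.isValue]
      rw [hTn0 p, ZMod.natCast_self, zero_smul, add_zero]
    · simp only [Fin.mk_one, Fin.isValue]
      exact hTn1 p
  -- `T` is invertible with inverse `T ^ (p - 1)`
  let e : V ≃ₗ[ZMod p] V := LinearEquiv.ofLinear T (T ^ (p - 1))
    (by rw [← Module.End.mul_eq_comp, ← pow_succ', Nat.sub_add_cancel hp1, hTp,
        Module.End.one_eq_id])
    (by rw [← Module.End.mul_eq_comp, ← pow_succ, Nat.sub_add_cancel hp1, hTp,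
        Module.End.one_eq_id])
  have he : ∀ x, e x = T x := fun x ↦ rfl
  refine ⟨e.toAddEquiv, ?_, ?_⟩
  · show e v = w
    rw [he, ← hb0, hT0, hb0, hb1, add_sub_cancel]
  · -- `n • γ` acts as `T ^ n`
    have hpow : ∀ (n : ℕ) (x : V), (n • (e.toAddEquiv : AddAut V)) x = (T ^ n) x := by
      intro n
      induction n with
      | zero => intro x; simp
      | succ n ih =>
        intro x
        rw [succ_nsmul, AddAut.add_apply, ih, pow_succ, Module.End.mul_apply]
        rfl
    ext x
    rw [hpow, hTp, AddAut.zero_apply, Module.End.one_apply]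

/-- In a plane over `𝔽_p`, any non-zero `v` can be moved to any non-zero `w` by at most two
unipotent shears; phrased for a shear-stable predicate. [folklore] -/
private theorem unipotent_transitive (p : ℕ) [Fact p.Prime] {V : Type*} [AddCommGroup V]
    [Module (ZMod p) V] (h2 : Module.finrank (ZMod p) V = 2) (S : V → Prop)
    (hS : ∀ γ : AddAut V, p • γ = 0 → ∀ x, S x → S (γ x)) {v w : V} (hv : v ≠ 0) (hw : w ≠ 0)
    (hSv : S v) : S w := by
  haveI : FiniteDimensional (ZMod p) V := .of_finrank_pos (by omega)
  by_cases hind : LinearIndependent (ZMod p) ![v, w - v]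
  · obtain ⟨γ, hγ, h5⟩ := exists_unipotent_apply_eq p h2 hind
    exact hγ ▸ hS γ h5 v hSv
  · -- `w = c • v`: go through an intermediate independent vector `v + q`
    rw [linearIndependent_fin2] at hind
    simp only [Matrix.cons_val_one, Matrix.cons_val_zero, ne_eq,
      not_and, not_forall, not_not] at hind
    by_cases hwv : w - v = 0
    · rw [sub_eq_zero] at hwv; exact hwv ▸ hSv
    obtain ⟨a, ha⟩ := hind hwv
    -- `a • (w - v) = v`, so `w = (1 + a⁻¹) • v =: c • v` with `c ≠ 0`
    have ha0 : a ≠ 0 := by rintro rfl; exact hv (by rw [← ha, zero_smul])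
    set c : ZMod p := 1 + a⁻¹ with hc
    have hwc : w = c • v := by
      have : w - v = a⁻¹ • v := by
        calc w - v = a⁻¹ • (a • (w - v)) := by rw [smul_smul, inv_mul_cancel₀ ha0, one_smul]
          _ = a⁻¹ • v := by rw [ha]
      rw [hc, add_smul, one_smul, ← this, add_sub_cancel]
    have hc0 : c ≠ 0 := by rintro h0; exact hw (by rw [hwc, h0, zero_smul])
    have h1 : 1 < Module.finrank (ZMod p) V := by omega
    obtain ⟨q, hq⟩ := exists_linearIndependent_pair_of_one_lt_finrank h1 hv
    -- step 1: `v ↦ v + q`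
    have hind1 : LinearIndependent (ZMod p) ![v, v + q - v] := by rwa [add_sub_cancel_left]
    obtain ⟨γ₁, hγ₁, h5₁⟩ := exists_unipotent_apply_eq p h2 hind1
    have hS1 : S (v + q) := hγ₁ ▸ hS γ₁ h5₁ v hSv
    -- step 2: `v + q ↦ w`; independence of `v + q` and `w - (v + q) = (c - 1) v - q`
    have hind2 : LinearIndependent (ZMod p) ![v + q, w - (v + q)] := by
      rw [LinearIndependent.pair_iff] at hq ⊢
      intro s t hst
      rw [hwc] at hst
      have key : (s + t * (c - 1)) • v + (s - t) • q = 0 := by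
        rw [← hst]; module
      obtain ⟨h1, h2'⟩ := hq _ _ key
      have hst' : s = t := sub_eq_zero.mp h2'
      subst hst'
      have : s * c = 0 := by linear_combination h1
      rcases mul_eq_zero.mp this with h | h
      · exact ⟨h, h⟩
      · exact absurd h hc0
    obtain ⟨γ₂, hγ₂, h5₂⟩ := exists_unipotent_apply_eq p h2 hind2
    exact hγ₂ ▸ hS γ₂ h5₂ (v + q) hS1

/-! ### Orbit of a root of a quadratic under one automorphism -/

/-- If `u ∈ L` is a root of a non-zero `c ∈ F[X]` of degree `≤ 2`, then `τ² u = u` for every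
`F`-automorphism `τ` of `L` (pigeonhole on `u, τu, τ²u` among the `≤ 2` roots of `c`). [folklore] -/
private theorem pow_two_apply_eq_self {F L : Type*} [Field F] [Field L] [Algebra F L] (c : F[X])
    (hc0 : c ≠ 0) (hc2 : c.natDegree ≤ 2) {u : L} (hcu : aeval u c = 0) (τ : L ≃ₐ[F] L) :
    (τ ^ 2) u = u := by
  set R := (c.map (algebraMap F L)).roots.toFinset with hR
  have hc0' : c.map (algebraMap F L) ≠ 0 := Polynomial.map_ne_zero hc0
  have hmem : ∀ i : ℕ, (τ ^ i) u ∈ R := by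
    intro i
    rw [hR, Multiset.mem_toFinset, mem_roots hc0', IsRoot.def, eval_map, ← aeval_def,
      aeval_algHom_apply, hcu, map_zero]
  have hcardR : R.card ≤ 2 :=
    (Multiset.toFinset_card_le _).trans ((card_roots' _).trans ((natDegree_map_le).trans hc2))
  obtain ⟨i, j, hij, he⟩ := Fintype.exists_ne_map_eq_of_card_lt
    (fun i : Fin 3 ↦ (⟨(τ ^ (i : ℕ)) u, hmem i⟩ : R)) (by simpa using by omega)
  simp only [Subtype.mk.injEq] at he
  wlog hlt : (i : ℕ) < j generalizing i j
  · exact this j i hij.symm he.symm (by omega)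
  have hd : (τ ^ ((j : ℕ) - i)) u = u := by
    have : (τ ^ (i : ℕ)) ((τ ^ ((j : ℕ) - i)) u) = (τ ^ (i : ℕ)) u := by
      rw [← AlgEquiv.mul_apply, ← pow_add, Nat.add_sub_cancel' hlt.le, ← he]
    exact (τ ^ (i : ℕ)).injective this
  have hiter : ∀ k : ℕ, ((τ ^ ((j : ℕ) - i)) ^ k) u = u := by
    intro k
    induction k with
    | zero => simp
    | succ k ih => rw [pow_succ, AlgEquiv.mul_apply, hd, ih]
  have hdvd : ((j : ℕ) - i) ∣ 2 := by
    have h1 : 1 ≤ (j : ℕ) - i := by omega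
    have h3 : (j : ℕ) - i ≤ 2 := by omega
    interval_cases ((j : ℕ) - i) <;> decide
  obtain ⟨k, hk⟩ := hdvd
  rw [hk, pow_mul]
  exact hiter k

/-! ### The quadratic-field criterion at an odd prime -/

variable (W : WeierstrassCurve ℚ) [W.IsElliptic]

/-- Elements of `ℚ⟮u⟯` are fixed by every `τ ∈ Γ_ℚ` fixing `u` (`u` algebraic). [folklore] -/
private theorem apply_eq_self_of_mem_adjoin {u : AlgebraicClosure ℚ} (hu : _root_.IsIntegral ℚ u)
    (τ : absoluteGaloisGroup ℚ) (hτ : τ • u = u) {z : AlgebraicClosure ℚ} (hz : z ∈ ℚ⟮u⟯) :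
    τ • z = z := by
  set τ' : AlgebraicClosure ℚ ≃ₐ[ℚ] AlgebraicClosure ℚ := τ
  have hz' : z ∈ Algebra.adjoin ℚ {u} := by
    rw [← IntermediateField.adjoin_simple_toSubalgebra_of_isAlgebraic hu.isAlgebraic]; exact hz
  have hle : Algebra.adjoin ℚ {u} ≤ AlgHom.equalizer (τ' : _ →ₐ[ℚ] _) (AlgHom.id ℚ _) :=
    Algebra.adjoin_le (Set.singleton_subset_iff.mpr (by
      rw [SetLike.mem_coe, AlgHom.mem_equalizer]; exact hτ))
  have := hle hz'
  rw [AlgHom.mem_equalizer] at this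
  exact this

/-- **Quadratic-field division-polynomial criterion (odd `p`).** Let `E = W/ℚ` be elliptic, `p` an
odd prime, `u ∈ ℚ̄` a root of a non-zero rational polynomial `c` of degree `≤ 2`, and `g ∈ ℚ⟮u⟯[X]`
    with
`0 < deg g ≤ p` a factor of `ψ_p` over `ℚ⟮u⟯`. Then `ρ̄_{E,p}` is not surjective. [cite: Serre1972,
    §2.1]
[cite: Zywina2015, §1.4 (N_s(7)), §1.3] [cite: SilvermanAEC2009, Exercise 3.7 (f)] -/
theorem not_hasSurjectiveModNGaloisRep_of_dvd_preΨ_quadratic (p : ℕ) [Fact p.Prime] (hp2 : p ≠ 2)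
    {u : AlgebraicClosure ℚ} (c : ℚ[X]) (hc0 : c ≠ 0) (hc2 : c.natDegree ≤ 2) (hcu : aeval u c = 0)
    (g : (ℚ⟮u⟯)[X]) (hdeg0 : 0 < g.natDegree) (hdeg : g.natDegree ≤ p)
    (hdvd : g ∣ (W.baseChange ℚ⟮u⟯).preΨ (p : ℤ)) :
    ¬ W.HasSurjectiveModNGaloisRep (p : ℤ) := by
  intro hs
  have hp : p.Prime := Fact.out
  have hpQ : (p : ℚ) ≠ 0 := by exact_mod_cast hp.ne_zero
  have hu : _root_.IsIntegral ℚ u := _root_.IsAlgebraic.isIntegral ⟨c, hc0, hcu⟩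
  -- the factor over `L`
  set g' : (AlgebraicClosure ℚ)[X] := g.map (algebraMap (ℚ⟮u⟯) (AlgebraicClosure ℚ)) with hg'
  have hg'deg : g'.natDegree = g.natDegree := natDegree_map _
  have hg'0 : g' ≠ 0 := by intro h; rw [h, natDegree_zero] at hg'deg; omega
  have hodd : ¬ Even (p : ℤ) := by
    rw [Int.even_coe_nat, Nat.not_even_iff_odd]; exact hp.odd_of_ne_two hp2
  have hpre : (W.baseChange (AlgebraicClosure ℚ)).preΨ (p : ℤ) =
      ((W.baseChange (ℚ⟮u⟯)).preΨ (p : ℤ)).map (algebraMap (ℚ⟮u⟯) (AlgebraicClosure ℚ)) := by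
    rw [← map_preΨ]
    show (W.map (algebraMap ℚ (AlgebraicClosure ℚ))).preΨ _ =
      ((W.map (algebraMap ℚ (ℚ⟮u⟯))).map (algebraMap (ℚ⟮u⟯) (AlgebraicClosure ℚ))).preΨ _
    rw [map_map, ← IsScalarTower.algebraMap_eq]
  have hdvd' : g' ∣ (W.baseChange (AlgebraicClosure ℚ)).ΨSq (p : ℤ) := by
    have h2 : g' ∣ (W.baseChange (AlgebraicClosure ℚ)).preΨ (p : ℤ) := by
      rw [hpre, hg']; exact Polynomial.map_dvd _ hdvd
    have h3 : (W.baseChange (AlgebraicClosure ℚ)).ΨSq (p : ℤ) =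
        (W.baseChange (AlgebraicClosure ℚ)).preΨ (p : ℤ) ^ 2 := by
      rw [ΨSq, if_neg hodd, mul_one]
    rw [h3]; exact h2.trans (dvd_pow_self _ two_ne_zero)
  -- a torsion point `P` in `S` and a torsion point `R₀` outside `S`
  obtain ⟨α, hα⟩ := IsAlgClosed.exists_root g' (by
    rw [degree_eq_natDegree hg'0, hg'deg]; exact_mod_cast hdeg0.ne')
  have hΨα : ((W.baseChange (AlgebraicClosure ℚ)).ΨSq (p : ℤ)).eval α = 0 := by
    obtain ⟨r, hr⟩ := hdvd'; rw [hr, eval_mul, show g'.eval α = 0 from hα, zero_mul]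
  obtain ⟨P, yP, hP, hPe⟩ := W.exists_geomTorsion_of_eval_ΨSq_eq_zero (p : ℤ) hΨα
  have hP0 : P ≠ 0 := fun h ↦ by
    have := congrArg Subtype.val h; rw [hPe] at this; exact Affine.Point.some_ne_zero _ this
  obtain ⟨R₀, x₀, y₀, hR, hRe, hgR⟩ :=
    W.exists_geomTorsion_eval_ne_zero p hp2 hpQ g' hg'0 (hg'deg ▸ hdeg)
  have hR0 : R₀ ≠ 0 := fun h ↦ by
    have := congrArg Subtype.val h; rw [hRe] at this; exact Affine.Point.some_ne_zero _ this
  -- the predicate `S`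
  let S : geomTorsion W (p : ℤ) → Prop := fun Q ↦
    ∃ (x y : AlgebraicClosure ℚ) (h : (W.baseChange (AlgebraicClosure ℚ)).toAffine.Nonsingular x y),
      (Q : geomPoints W) = Affine.Point.some x y h ∧ g'.eval x = 0
  have hSP : S P := ⟨α, yP, hP, hPe, hα⟩
  have hSR : ¬ S R₀ := by
    rintro ⟨x, y, h, hQ, hx⟩
    rw [hRe] at hQ
    have := (Affine.Point.some.inj hQ).1
    exact hgR (this ▸ hx)
  -- `S` is stable under the stabiliser of `u`
  have hstab : ∀ τ : absoluteGaloisGroup ℚ, τ • u = u → ∀ Q, S Q → S (τ • Q) := by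
    intro τ hτ Q ⟨x, y, h, hQ, hx⟩
    obtain ⟨h', e'⟩ : ∃ h', τ • (show geomPoints W from Affine.Point.some x y h) =
        (Affine.Point.some (τ • x) (τ • y) h' : geomPoints W) := ⟨_, rfl⟩
    refine ⟨τ • x, τ • y, h', ?_, ?_⟩
    · show τ • (Q : geomPoints W) = _
      rw [hQ]
      exact e'
    · set τ' : AlgebraicClosure ℚ ≃ₐ[ℚ] AlgebraicClosure ℚ := τ
      let τK : AlgebraicClosure ℚ →ₐ[ℚ⟮u⟯] AlgebraicClosure ℚ :=
        { (τ' : AlgebraicClosure ℚ →+* AlgebraicClosure ℚ) with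
          commutes' := fun z ↦ apply_eq_self_of_mem_adjoin hu τ hτ z.2 }
      have hτK : ∀ z, τK z = τ • z := fun z ↦ rfl
      have : g'.eval (τ • x) = τK (g'.eval x) := by
        rw [hg', Polynomial.eval_map_algebraMap, Polynomial.eval_map_algebraMap, ← hτK]
        exact Polynomial.aeval_algHom_apply τK x g
      rw [this, hx, map_zero]
  -- every unipotent automorphism of `E[p]` is `ρ̄(τ²)` with `τ² u = u`, hence stabilises `S`
  letI : Module (ZMod p) (geomTorsion W (p : ℤ)) := AddSubgroup.torsionBy.zmodModule
  have h2 : Module.finrank (ZMod p) (geomTorsion W (p : ℤ)) = 2 := W.finrank_geomTorsion_eq_two p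
      hpQ
  obtain ⟨k, hk⟩ : ∃ k : ℕ, p + 1 = k + k := (hp.odd_of_ne_two hp2).add_one
  rw [← two_mul] at hk
  have hunip : ∀ γ : AddAut (geomTorsion W (p : ℤ)), p • γ = 0 → ∀ Q, S Q → S (γ Q) := by
    intro γ hγ Q hQ
    obtain ⟨τ, hτ⟩ := hs (Multiplicative.ofAdd (k • γ))
    have h2u : (τ ^ 2) • u = u := pow_two_apply_eq_self c hc0 hc2 hcu τ
    have hact : (τ ^ 2) • Q = γ Q := by
      have h := galoisRepTorsion_apply W (p : ℤ) (τ ^ 2) Q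
      rw [map_pow, hτ, ← ofAdd_nsmul, toAdd_ofAdd, smul_smul,
        show (2 * k) • γ = γ by rw [← hk, add_nsmul, hγ, zero_add, one_nsmul]] at h
      exact h.symm
    exact hact ▸ hstab (τ ^ 2) h2u Q hQ
  exact hSR (unipotent_transitive p h2 S hunip hP0 hR0 hSP)

end WeierstrassCurve

end
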